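import Mathlib
import HarnessLib
import Literature.MathematicalPhysics.KineticTheory.HardSphereEuler
import Literature.MathematicalPhysics.KineticTheory.BackwardCluster
import Summits.AtomisticToContinuum.HydrodynamicLimit.Theses.RelayRaceLocality

/-!
# Sketch — crux-ideate round 2, ideator 5, crux `RelayRaceLocality.GibbsLightCone`
(stmt-AtomisticToContinuum-12501). First lemmas / transferred statements of the two idea cards
`ghost-tracer-void` and `dilute-hyperbolic-freshness`. Nothing here is proved; everything must
elaborate. Namespace is private to this seat.
-/

namespace Summit.AtomisticToContinuum.HydrodynamicLimit.Cruxes.GibbsLightCone.IdeatorFive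

open Literature.MathematicalPhysics.KineticTheory Literature.Analysis.FluidPDE MeasureTheory Filter Set
open scoped ENNReal InnerProductSpace

/-! ## Card `ghost-tracer-void` -/

/-- FIRST LEMMA (card `ghost-tracer-void`): **ghost identity**. Under the homogeneous Gibbs law of
`N+1` spheres, the event "particle `0` has no collision during `(0,T]`" (its APST backward cluster
over `(0,T]` is empty) has the same probability as the event "the free world-line of particle `0` stays
at distance `> ε_N` from the AUTONOMOUS `N`-sphere flow `Ψ` of the other particles" — on the survival
event the tagged sphere never influenced the bath, and conversely (forward uniqueness, a.e.). -/
def GhostIdentity : Prop :=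
  ∀ σ a θ : ℝ, 0 < σ → ∀ N : ℕ,
    ∀ (Φ : HardSphereFlow (Torus.geometry (Fin 3)) (hsDiameter σ N) (N + 1))
      (Ψ : HardSphereFlow (Torus.geometry (Fin 3)) (hsDiameter σ N) N),
    ∀ T : ℝ, 0 ≤ T →
      localGibbsLaw σ (fun _ => a) (fun _ => 0) (fun _ => θ) N Φ
          {z | Φ.backwardCluster 0 0 T z = ∅}
        = localGibbsLaw σ (fun _ => a) (fun _ => 0) (fun _ => θ) N Φ
          {z | ∀ s ∈ Set.Icc 0 T, ∀ q : Fin N,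
              hsDiameter σ N < Torus.euclidDist ((Ψ.flow s (Fin.tail z)) q).1
                ((freeFlight (Torus.geometry (Fin 3)) s z) 0).1}

/-- TRANSFERRED STATEMENT C⁺ (card `ghost-tracer-void`): **space–time thin-tube void bound for the
UNPERTURBED equilibrium process** (no tagged particle at all). For the canonical Gibbs law of `N`
spheres of diameter `ε_N = hsDiameter σ N` and ANY hard-sphere flow `Ψ` of them, the probability that
no sphere comes within `ε_N` of a ghost point moving on a fixed straight world-line of speed
`≥ A√θ` for PATH LENGTH `y ℓ_N` (`ℓ_N = (N+1)^{-1/3}/σ²`) is `≤ C e^{-η y}`, for `1 ≤ y ≤ K log(N+2)`,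
eventually in `N`, constants fixed before `σ`. By `GhostIdentity` this is hot-flight survival damping
(the `n = 0` content of Y″, certified load-bearing p133876/p101553) with the tagged particle removed. -/
def SpaceTimeTubeVoid : Prop :=
  ∀ a θ : ℝ, 0 < a → 0 < θ → ∃ σ₀ : ℝ, 0 < σ₀ ∧ ∃ A η C : ℝ, 0 < A ∧ 0 < η ∧
    ∀ K : ℝ, 0 < K → ∀ σ : ℝ, 0 < σ → σ < σ₀ →
    ∀ Ψ : (N : ℕ) → HardSphereFlow (Torus.geometry (Fin 3)) (hsDiameter σ N) N,
    ∀ᶠ N : ℕ in atTop, ∀ (x₀ : T3) (v₀ : V3), A * Real.sqrt θ ≤ ‖v₀‖ →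
      ∀ y : ℝ, 1 ≤ y → y ≤ K * Real.log ((N : ℝ) + 2) →
      particleLaw (Ψ N) (canonicalDensity (Torus.geometry (Fin 3)) (hsDiameter σ N) N
          (localGibbsProfile (fun _ => a) (fun _ => 0) (fun _ => θ)))
        {w | ∀ s ∈ Set.Icc 0 (y * (((N + 1 : ℕ) : ℝ) ^ (-(1 / 3 : ℝ)) / σ ^ 2) / ‖v₀‖),
            ∀ q : Fin N, hsDiameter σ N <
              Torus.euclidDist (((Ψ N).flow s w) q).1 ((Torus.geometry (Fin 3)).translate x₀ (s • v₀))}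
        ≤ ENNReal.ofReal (C * Real.exp (-η * y))

/-- SANITY ANCHOR (card `ghost-tracer-void`): the same void bound for the FREE-STREAMING hard-core bath
(initial data hard-core Gibbs, bath–bath collisions switched off: `freeFlight` in place of `Ψ.flow`).
This is a marked hard-core Boolean-model void probability — static cluster expansion + independent
Maxwellian marks — and is provable now; with i.i.d. uniform positions it is binomially exact. The
log-window cap on `y` keeps the tubes kinetic-scale (no Diophantine wrap-around on the torus). -/
def FreeStreamingTubeVoid : Prop :=
  ∀ a θ : ℝ, 0 < a → 0 < θ → ∃ σ₀ : ℝ, 0 < σ₀ ∧ ∃ A η C : ℝ, 0 < A ∧ 0 < η ∧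
    ∀ K : ℝ, 0 < K → ∀ σ : ℝ, 0 < σ → σ < σ₀ →
    ∀ Ψ : (N : ℕ) → HardSphereFlow (Torus.geometry (Fin 3)) (hsDiameter σ N) N,
    ∀ᶠ N : ℕ in atTop, ∀ (x₀ : T3) (v₀ : V3), A * Real.sqrt θ ≤ ‖v₀‖ →
      ∀ y : ℝ, 1 ≤ y → y ≤ K * Real.log ((N : ℝ) + 2) →
      particleLaw (Ψ N) (canonicalDensity (Torus.geometry (Fin 3)) (hsDiameter σ N) N
          (localGibbsProfile (fun _ => a) (fun _ => 0) (fun _ => θ)))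
        {w | ∀ s ∈ Set.Icc 0 (y * (((N + 1 : ℕ) : ℝ) ^ (-(1 / 3 : ℝ)) / σ ^ 2) / ‖v₀‖),
            ∀ q : Fin N, hsDiameter σ N <
              Torus.euclidDist ((freeFlight (Torus.geometry (Fin 3)) s w) q).1
                ((Torus.geometry (Fin 3)).translate x₀ (s • v₀))}
        ≤ ENNReal.ofReal (C * Real.exp (-η * y))

/-! ## Card `dilute-hyperbolic-freshness` -/

/-- FIRST LEMMA, part (a) (card `dilute-hyperbolic-freshness`): **energy share = squared normalised
impact offset**. For the tree's reflection law with contact direction `n ≠ 0` and a partner at rest,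
the partner receives exactly the normal share `⟪v,n⟫²/‖n‖²` of `‖v‖²` and the carrier keeps the
tangential share: the retained fraction is `U = 1 - cos²(incidence) = (b/ε)²`. -/
def EnergyShareIdentity : Prop :=
  ∀ n v : V3, n ≠ 0 →
    ‖(reflectVel n (v, (0 : V3))).2‖ ^ 2 = ⟪v, n⟫_ℝ ^ 2 / ‖n‖ ^ 2 ∧
    ‖(reflectVel n (v, (0 : V3))).1‖ ^ 2 = ‖v‖ ^ 2 - ⟪v, n⟫_ℝ ^ 2 / ‖n‖ ^ 2

/-- FIRST LEMMA, part (b) (card `dilute-hyperbolic-freshness`): **hard spheres scatter isotropically in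
`d = 3`**. The push-forward of the flux measure `(-⟪g,ω⟫)₊ dω` on the incoming hemisphere of contact
normals under `ω ↦ g' = g - 2⟪g,ω⟫ω` (post-collisional relative velocity of `reflectVel ω`) is
`‖g‖/4` times the uniform surface measure on the sphere of radius `‖g‖` (`dσ/dΩ = ε²/4`): a fresh
(flux-uniform) impact parameter gives a uniformly distributed outgoing relative direction. -/
def IsotropicScattering : Prop :=
  ∀ g : V3, g ≠ 0 → ∀ F : V3 → ℝ, Measurable F → (∃ B : ℝ, ∀ x, |F x| ≤ B) →
    ∫ (ω : Metric.sphere (0 : V3) 1),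
        max 0 (-⟪g, (ω : V3)⟫_ℝ) * F (g - (2 * ⟪g, (ω : V3)⟫_ℝ) • (ω : V3))
        ∂(volume : Measure V3).toSphere
      = ‖g‖ / 4 * ∫ (ω : Metric.sphere (0 : V3) 1), F (‖g‖ • (ω : V3)) ∂(volume : Measure V3).toSphere

/-- SUPPORT (card `dilute-hyperbolic-freshness`): **the label entropy of a necklace link is free** —
exchangeability of the labels outside the chain under the Gibbs law conditioned on a past link, plus
deterministic hard-core packing: for `q₂ ∉ {q₀, q₁}` and any fixed time `s`, the joint probability of
the slab-1 link `(q₀,q₁)` and of `q₂` sitting within `r` of `q₁` at time `s` is at most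
`2(2r/ε_N + 1)³/N ≥ (2r/ε_N+1)³/(N-1)` times the probability of the link alone (instance `m = 1`;
general `m` identical). -/
def LinkLabelExchangeability : Prop :=
  ∀ σ a θ : ℝ, 0 < σ → σ ≤ 1 / 2 → 0 < a → 0 < θ → ∀ N : ℕ, 1 ≤ N →
    ∀ Φ : HardSphereFlow (Torus.geometry (Fin 3)) (hsDiameter σ N) (N + 1),
    ∀ (q₀ q₁ q₂ : Fin (N + 1)), q₀ ≠ q₁ → q₂ ≠ q₀ → q₂ ≠ q₁ →
    ∀ (T₁ Δ s r : ℝ), 0 ≤ Δ → 0 ≤ r →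
      localGibbsLaw σ (fun _ => a) (fun _ => 0) (fun _ => θ) N Φ
        {z | (∃ u ∈ Set.Icc T₁ (T₁ + Δ),
              s(q₀, q₁) ∈ contactPairSet (Torus.geometry (Fin 3)) (hsDiameter σ N) (Φ.flow u z)) ∧
             Torus.euclidDist ((Φ.flow s z) q₁).1 ((Φ.flow s z) q₂).1 ≤ r}
        ≤ ENNReal.ofReal (2 * (2 * r / hsDiameter σ N + 1) ^ 3 / N) *
          localGibbsLaw σ (fun _ => a) (fun _ => 0) (fun _ => θ) N Φ
            {z | ∃ u ∈ Set.Icc T₁ (T₁ + Δ),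
              s(q₀, q₁) ∈ contactPairSet (Torus.geometry (Fin 3)) (hsDiameter σ N) (Φ.flow u z)}

/-- FIRST CRUX-LEVEL STATEMENT (card `dilute-hyperbolic-freshness`): **two-link grazing-band bound** —
X″ at `n = 2` sharpened by the flux weight of the incidence band: prescribing that the SECOND link
`(q₁,q₂)` be near-grazing, `|⟪n, g⟫| ≤ α ε_N ‖g‖` (impact offset `b ≥ ε_N √(1-α²)`), costs the extra
factor `C α²` on top of the two-link necklace bound — i.e. the impact parameter of the second link is
FRESH (flux-uniform up to a constant) given the first link. Unconditionally the `α²` is exact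
(Campbell); the content is that conditioning on the past link does not concentrate incidence. -/
def TwoLinkGrazingBand : Prop :=
  ∀ a θ : ℝ, 0 < a → 0 < θ → ∃ σ₀ : ℝ, 0 < σ₀ ∧ ∃ C C₁ Λ : ℝ, 0 ≤ C ∧ 0 ≤ C₁ ∧ 1 ≤ Λ ∧
    ∀ K : ℝ, 0 < K → ∀ σ : ℝ, 0 < σ → σ < σ₀ →
    ∀ Φ : (N : ℕ) → HardSphereFlow (Torus.geometry (Fin 3)) (hsDiameter σ N) (N + 1),
    ∀ᶠ N : ℕ in atTop, ∀ M : ℝ, 1 ≤ M → M ≤ K * Real.log ((N : ℝ) + 2) →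
      ∀ Δ : ℝ, 0 < Δ → Δ ≤ hsDiameter σ N / Real.sqrt θ →
      ∀ α : ℝ, 0 < α → α ≤ 1 →
      ∀ (q₀ q₁ q₂ : Fin (N + 1)) (T₁ T₂ : ℝ), q₀ ≠ q₁ → q₁ ≠ q₂ → q₀ ≠ q₂ →
        0 ≤ T₁ → T₁ + Δ ≤ T₂ →
        T₂ + Δ ≤ M * (((N + 1 : ℕ) : ℝ) ^ (-(1 / 3 : ℝ)) / σ ^ 2 / Real.sqrt θ) →
      localGibbsLaw σ (fun _ => a) (fun _ => 0) (fun _ => θ) N (Φ N)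
        {z | (∃ u ∈ Set.Icc T₁ (T₁ + Δ),
                s(q₀, q₁) ∈ contactPairSet (Torus.geometry (Fin 3)) (hsDiameter σ N) ((Φ N).flow u z)) ∧
             (∃ u ∈ Set.Icc T₂ (T₂ + Δ),
                s(q₁, q₂) ∈ contactPairSet (Torus.geometry (Fin 3)) (hsDiameter σ N) ((Φ N).flow u z) ∧
                (let nvec : V3 := (Torus.geometry (Fin 3)).sepVec (((Φ N).flow u z) q₁).1 (((Φ N).flow u z) q₂).1
                 let g : V3 := (((Φ N).flow u z) q₁).2 - (((Φ N).flow u z) q₂).2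
                 |⟪nvec, g⟫_ℝ| ≤ α * hsDiameter σ N * ‖g‖))}
        ≤ ENNReal.ofReal (C * α ^ 2 * (C₁ * (hsDiameter σ N + Λ * Real.sqrt θ * Δ) ^ 3) ^ 2)

end Summit.AtomisticToContinuum.HydrodynamicLimit.Cruxes.GibbsLightCone.IdeatorFive
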